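import Summits.KontsevichZagierPeriods.KontsevichZagierPeriods.Theorems.LinRedNormalFormArrangementNormalFormSeparateEngine

/-!
# Separation engine (line `janus-bands`, crux `ArrangementNormalForm`), part 2: literal data

The engine `SeparatePos.sep_induction` instantiated on LITERAL Janus-band data over the base
`ℝ^{b+1}` with `k` fibres (the text of the skeleton classes `JJ (b+1) k` / `GG b 1 k`):

* `separatePos_of_dominated` (registered sub-goal) — `y`-free numerator
  (`p = rename Fin.castSucc p₀`), every active `y`-letter `L_j = α_j (y − λ_j(x'))`
  (`α_j = (L j).1 (Fin.last b) ≠ 0`, `e_j ≠ 0`) non-vanishing on the domain, and the RATIO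
  condition `|L_{j'}| ≤ C |α_j L_{j'} − α_{j'} L_j|` on the domain for every ordered pair of
  non-proportional active letters (`α_j L_{j'} − α_{j'} L_j = α_j α_{j'} (λ_j − λ_{j'})` is the
  `y`-free resultant form; walls `{λ_j = λ_{j'}}` may touch the closed cell, but only inside the
  flat `{L_j = L_{j'} = 0}`) ⟹ `∃ c ∈ closure (GG b 1 k), [s] − c ∈ KZ.relations`;
* `separatePos_of_wallFree` (registered sub-goal) — the same with the ratio condition replaced
  by: every resultant form is bounded away from `0` on the (bounded) domain (NO WALL meets the
  closed base cell).

* `separatePos_carry` (registered sub-goal) — the same engine with a GENERAL numerator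
  `P(x', y)` (`p : MvPolynomial (Fin (b + 1)) ℚ`, the literal `JJ (b+1) k` integrand; the
  engine never touches the numerator) ⟹ `[s]` is congruent to a `ℤ`-combination of elements of
  the intermediate class `GG♮ b k` (`SeparatePos.GNset`, written out literally): integrand
  `P(x', y)/∏ Lⱼ(x')^{eⱼ} · (y − ℓ(x'))^{−n} · (fibre block)` with ONE `y`-pole, non-vanishing on
  the domain. What separates `GG♮ b k` from `GG b 1 k` is exactly the additive split
  `P = ∑ᵢ Pᵢ(x') (y − ℓ)^i` of the numerator, whose termwise absolute convergence is NOT implied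
  by domination when `P` vanishes on the closed cell.

Dictionary `SeparatePos.jshape_eq` (literal integrand = separation shape, via `root`, `lead`,
`restr` of part 1).
-/

noncomputable section

open Set MeasureTheory MvPolynomial

namespace Summit.KontsevichZagierPeriods.ArrangementNormalForm.JanusBands

open Literature.NumberTheory.Transcendental

namespace SeparatePos

variable {b k m : ℕ}

/-- A `y`-free full-base form is its restriction. -/
theorem affF_of_eq_zero (c : (Fin (b + 1) → ℚ) × ℚ) (z : Fin (b + 1 + k) → ℝ)
    (h : c.1 (Fin.last b) = 0) : affF b k c z = affB b k (restr b c) z := by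
  simp [affF, affB, restr, Fin.sum_univ_castSucc, h]

/-- A `y`-letter factors as `α (y − λ(x'))`. -/
theorem affF_of_ne_zero (c : (Fin (b + 1) → ℚ) × ℚ) (z : Fin (b + 1 + k) → ℝ)
    (h : c.1 (Fin.last b) ≠ 0) : affF b k c z =
      (c.1 (Fin.last b) : ℝ) * (z (Fin.castAdd k (Fin.last b)) - affB b k (root b c) z) := by
  have hα : (c.1 (Fin.last b) : ℝ) ≠ 0 := by exact_mod_cast h
  simp only [affF, affB, root, Fin.sum_univ_castSucc, Rat.cast_div, Rat.cast_neg, mul_sub,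
    mul_add, Finset.mul_sum]
  have h1 : ∀ i, (c.1 (Fin.last b) : ℝ) * (-(c.1 (Fin.castSucc i) : ℝ) / (c.1 (Fin.last b) : ℝ) *
      z (Fin.castAdd k (Fin.castSucc i))) =
      -((c.1 (Fin.castSucc i) : ℝ) * z (Fin.castAdd k (Fin.castSucc i))) := fun i => by
    field_simp
  simp only [h1, Finset.sum_neg_distrib]
  field_simp
  ring

/-- Powers of full-base forms in separation shape. -/
theorem affF_pow_eq (c : (Fin (b + 1) → ℚ) × ℚ) (n : ℕ) (z : Fin (b + 1 + k) → ℝ) :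
    affF b k c z ^ n = affB b k (if c.1 (Fin.last b) = 0 then restr b c else (0, 1)) z ^
      (if c.1 (Fin.last b) = 0 then n else 0) * ((lead b c n : ℝ) *
      (z (Fin.castAdd k (Fin.last b)) - affB b k (root b c) z) ^
        (if c.1 (Fin.last b) = 0 then 0 else n)) := by
  unfold lead
  split_ifs with h
  · simp [affF_of_eq_zero c z h]
  · rw [affF_of_ne_zero c z h, mul_pow]
    simp [affB]

/-- A Janus band integrand (any numerator) is of separation shape. -/
theorem jshape_eq (L : Fin m → (Fin (b + 1) → ℚ) × ℚ) (e : Fin m → ℕ)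
    (p : MvPolynomial (Fin (b + 1)) ℚ)
    (a : Fin k → Option ((Fin (b + 1) → ℚ) × ℚ)) (z : Fin (b + 1 + k) → ℝ) :
    MvPolynomial.aeval (fun i => z (Fin.castAdd k i)) p /
      (∏ j, (∑ i, ((L j).1 i : ℝ) * z (Fin.castAdd k i) + ((L j).2 : ℝ)) ^ e j) * fib b k a z =
    shape b k (MvPolynomial.C (∏ j, lead b (L j) (e j))⁻¹ * p)
      (fun j => if (L j).1 (Fin.last b) = 0 then restr b (L j) else (0, 1))
      (fun j => if (L j).1 (Fin.last b) = 0 then e j else 0) (fun j => root b (L j))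
      (fun j => if (L j).1 (Fin.last b) = 0 then 0 else e j) a z := by
  show MvPolynomial.aeval (fun i => z (Fin.castAdd k i)) p /
      (∏ j, affF b k (L j) z ^ e j) * fib b k a z = _
  simp only [shape, affF_pow_eq, Finset.prod_mul_distrib, map_mul,
    MvPolynomial.aeval_C, eq_ratCast, Rat.cast_inv, Rat.cast_prod]
  simp only [div_eq_mul_inv, mul_inv, Finset.prod_inv_distrib]
  ring

/-- A priori bound for a full-base affine form on a ball. -/
theorem abs_affF_le (c : (Fin (b + 1) → ℚ) × ℚ) {R : ℝ} {z : Fin (b + 1 + k) → ℝ}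
    (hz : ‖z‖ ≤ R) : |affF b k c z| ≤ (∑ i, |(c.1 i : ℝ)|) * R + |(c.2 : ℝ)| := by
  have hzj : ∀ j, |z j| ≤ R := fun j => le_trans (by simp [← Real.norm_eq_abs, norm_le_pi_norm]) hz
  unfold affF
  refine (abs_add_le _ _).trans (add_le_add_left ?_ _)
  rw [Finset.sum_mul]
  refine (Finset.abs_sum_le_sum_abs _ _).trans (Finset.sum_le_sum fun i _ => ?_)
  rw [abs_mul]
  exact mul_le_mul_of_nonneg_left (hzj _) (abs_nonneg _)

/-- Proportional `y`-letters have the same root. -/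
theorem root_eq_of_smul_eq {c c' : (Fin (b + 1) → ℚ) × ℚ} (hc : c.1 (Fin.last b) ≠ 0)
    (hc' : c'.1 (Fin.last b) ≠ 0) (h : c'.1 (Fin.last b) • c = c.1 (Fin.last b) • c') :
    root b c = root b c' := by
  have h1 : ∀ i, c'.1 (Fin.last b) * c.1 i = c.1 (Fin.last b) * c'.1 i := fun i => by
    simpa using congr_arg (fun q => q.1 i) h
  have h2 : c'.1 (Fin.last b) * c.2 = c.1 (Fin.last b) * c'.2 := by
    simpa using congr_arg Prod.snd h
  refine Prod.ext (funext fun i => ?_) ?_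
  · show -c.1 (Fin.castSucc i) / c.1 (Fin.last b) = -c'.1 (Fin.castSucc i) / c'.1 (Fin.last b)
    rw [div_eq_div_iff hc hc']
    linear_combination -(h1 (Fin.castSucc i))
  · show -c.2 / c.1 (Fin.last b) = -c'.2 / c'.1 (Fin.last b)
    rw [div_eq_div_iff hc hc']
    linear_combination -h2

/-- The literal ratio condition `|L'| ≤ C |α L' − α' L|` gives the engine's ratio condition
`|y − λ'| ≤ C |α| · |λ − λ'|`. -/
theorem ratio_of_literal (c c' : (Fin (b + 1) → ℚ) × ℚ) (hc : c.1 (Fin.last b) ≠ 0)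
    (hc' : c'.1 (Fin.last b) ≠ 0) (z : Fin (b + 1 + k) → ℝ) {C : ℝ}
    (h : |affF b k c' z| ≤
      C * |(c.1 (Fin.last b) : ℝ) * affF b k c' z - (c'.1 (Fin.last b) : ℝ) * affF b k c z|) :
    |z (Fin.castAdd k (Fin.last b)) - affB b k (root b c') z| ≤
      C * |(c.1 (Fin.last b) : ℝ)| * |affB b k (root b c) z - affB b k (root b c') z| := by
  have hα : (c.1 (Fin.last b) : ℝ) ≠ 0 := by exact_mod_cast hc
  have hα' : (c'.1 (Fin.last b) : ℝ) ≠ 0 := by exact_mod_cast hc'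
  rw [affF_of_ne_zero c z hc, affF_of_ne_zero c' z hc'] at h
  set y := z (Fin.castAdd k (Fin.last b))
  set u := affB b k (root b c) z
  set u' := affB b k (root b c') z
  have h2 : (c.1 (Fin.last b) : ℝ) * ((c'.1 (Fin.last b) : ℝ) * (y - u')) -
      (c'.1 (Fin.last b) : ℝ) * ((c.1 (Fin.last b) : ℝ) * (y - u)) =
      (c'.1 (Fin.last b) : ℝ) * ((c.1 (Fin.last b) : ℝ) * (u - u')) := by ring
  rw [h2, abs_mul, abs_mul, abs_mul] at h
  have hpos : 0 < |(c'.1 (Fin.last b) : ℝ)| := abs_pos.mpr hα'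
  refine le_of_mul_le_mul_left ?_ hpos
  calc |(c'.1 (Fin.last b) : ℝ)| * |y - u'| ≤
      C * (|(c'.1 (Fin.last b) : ℝ)| * (|(c.1 (Fin.last b) : ℝ)| * |u - u'|)) := h
    _ = |(c'.1 (Fin.last b) : ℝ)| * (C * |(c.1 (Fin.last b) : ℝ)| * |u - u'|) := by ring

end SeparatePos

open SeparatePos in
/-- **Dominated separation** (registered sub-goal of `stub_separatePos` / `stub_separateZero`).
Let `s` be a Janus band representation over the base `ℝ^{b+1}` with `k` fibres (literal
`JJ (b+1) k` data) whose rational part has a `y`-FREE numerator (`p = rename castSucc p₀`,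
`y = z (Fin.last b)`), whose active `y`-letters `L_j` (`(L j).1 (Fin.last b) ≠ 0`, `e j ≠ 0`)
do not vanish on the domain, and which satisfies the RATIO condition
`|L_{j'}(z)| ≤ C · |α_j L_{j'}(z) − α_{j'} L_j(z)|` on the domain for every ordered pair of
non-proportional active letters (`α_j = (L j).1 (Fin.last b)`; the right-hand side is
`|α_j α_{j'}| · |λ_j(x') − λ_{j'}(x')|`). Then `[s]` is congruent modulo `KZ.relations` to a
`ℤ`-combination of elements of `GG b 1 k`: iterated rule (1b) with dominated pieces
(`SeparatePos.sep_induction`), the resultant forms joining the `x'`-denominators. -/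
theorem separatePos_of_dominated (GG : ℕ → ℕ → ℕ → Set KZ.FormalRep) (hGG : ∀ b σ k, GG b σ k = {w : KZ.FormalRep | ∃ (m m' n₁ n₂ : ℕ) (s : KZ.IntegralRep (b + 1 + k)) (M : Fin m' → (Fin (b + 1) → ℚ) × ℚ) (L : Fin m → (Fin b → ℚ) × ℚ) (e : Fin m → ℕ) (p : MvPolynomial (Fin b) ℚ) (ℓ₁ ℓ₂ : (Fin b → ℚ) × ℚ) (a : Fin k → Option ((Fin (b + 1) → ℚ) × ℚ)) (lo hi : Fin k → Fin k ⊕ ((Fin (b + 1) → ℚ) × ℚ)), (n₁ = 0 ∨ n₂ = 0) ∧ (σ = 2 → (∀ i c, a i = some c → c.1 (Fin.last b) = 0) ∧ (∀ i c, (lo i = Sum.inr c ∨ hi i = Sum.inr c) → (c.1 (Fin.last b) = 0 ∨ c = (Pi.single (Fin.last b) 1, 0)))) ∧ Bornology.IsBounded s.domain ∧ s.domain = {z | (∀ j, 0 < ∑ i, ((M j).1 i : ℝ) * z (Fin.castAdd k i) + ((M j).2 : ℝ)) ∧ ∀ i, Sum.elim (fun j => z (Fin.natAdd (b + 1) j))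 (fun c => ∑ i', (c.1 i' : ℝ) * z (Fin.castAdd k i') + (c.2 : ℝ)) (lo i) < z (Fin.natAdd (b + 1) i) ∧ z (Fin.natAdd (b + 1) i) < Sum.elim (fun j => z (Fin.natAdd (b + 1) j)) (fun c => ∑ i', (c.1 i' : ℝ) * z (Fin.castAdd k i') + (c.2 : ℝ)) (hi i)} ∧ EqOn s.integrand (fun z => MvPolynomial.aeval (fun i => z (Fin.castAdd k (Fin.castSucc i))) p / (∏ j, (∑ i, ((L j).1 i : ℝ) * z (Fin.castAdd k (Fin.castSucc i)) + ((L j).2 : ℝ)) ^ e j) * ((z (Fin.castAdd k (Fin.last b)) - (∑ i, (ℓ₁.1 i : ℝ) * z (Fin.castAdd k (Fin.castSucc i)) + (ℓ₁.2 : ℝ))) ^ n₁ / (z (Fin.castAdd k (Fin.last b)) - (∑ i, (ℓ₂.1 i : ℝ) * z (Fin.castAdd k (Fin.castSucc i)) + (ℓ₂.2 : ℝ))) ^ n₂) * ∏ i, (a i).elim 1 (fun c => 1 / (z (Fin.natAdd (b + 1) i) - (∑ i', (c.1 i' : ℝ) * z (Fin.castAdd k i') + (c.2 : ℝ))))) s.domain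 ∧ w = KZ.of s}) (b k m m' : ℕ) (s : KZ.IntegralRep (b + 1 + k)) (M : Fin m' → (Fin (b + 1) → ℚ) × ℚ) (L : Fin m → (Fin (b + 1) → ℚ) × ℚ) (e : Fin m → ℕ) (p₀ : MvPolynomial (Fin b) ℚ) (a : Fin k → Option ((Fin (b + 1) → ℚ) × ℚ)) (lo hi : Fin k → Fin k ⊕ ((Fin (b + 1) → ℚ) × ℚ)) (hbd : Bornology.IsBounded s.domain) (hdom : s.domain = {z | (∀ j, 0 < ∑ i, ((M j).1 i : ℝ) * z (Fin.castAdd k i) + ((M j).2 : ℝ)) ∧ ∀ i, Sum.elim (fun j => z (Fin.natAdd (b + 1) j)) (fun c => ∑ i', (c.1 i' : ℝ) * z (Fin.castAdd k i') + (c.2 : ℝ)) (lo i) < z (Fin.natAdd (b + 1) i) ∧ z (Fin.natAdd (b + 1) i) < Sum.elim (fun j => z (Fin.natAdd (b + 1) j)) (fun c => ∑ i', (c.1 i' : ℝ) * z (Fin.castAdd k i') + (c.2 : ℝ)) (hi i)}) (hint : EqOn s.integrand (fun z => MvPolynomial.aeval (fun i => z (Fin.castAdd k i)) (MvPolynomial.rename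 Fin.castSucc p₀) / (∏ j, (∑ i, ((L j).1 i : ℝ) * z (Fin.castAdd k i) + ((L j).2 : ℝ)) ^ e j) * ∏ i, (a i).elim 1 (fun c => 1 / (z (Fin.natAdd (b + 1) i) - (∑ i', (c.1 i' : ℝ) * z (Fin.castAdd k i') + (c.2 : ℝ))))) s.domain) (hpole : ∀ j, (L j).1 (Fin.last b) ≠ 0 → e j ≠ 0 → ∀ z ∈ s.domain, ∑ i, ((L j).1 i : ℝ) * z (Fin.castAdd k i) + ((L j).2 : ℝ) ≠ 0) (hrat : ∀ j j', (L j).1 (Fin.last b) ≠ 0 → (L j').1 (Fin.last b) ≠ 0 → e j ≠ 0 → e j' ≠ 0 → (L j').1 (Fin.last b) • L j ≠ (L j).1 (Fin.last b) • L j' → ∃ C : ℝ, ∀ z ∈ s.domain, |∑ i, ((L j').1 i : ℝ) * z (Fin.castAdd k i) + ((L j').2 : ℝ)| ≤ C * |((L j).1 (Fin.last b) : ℝ) * (∑ i, ((L j').1 i : ℝ) * z (Fin.castAdd k i) + ((L j').2 : ℝ)) - ((L j').1 (Fin.last b) : ℝ) * (∑ i, ((L j).1 i : ℝ) * z (Fin.castAdd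 k i) + ((L j).2 : ℝ))|) : ∃ c ∈ AddSubgroup.closure (GG b 1 k), KZ.of s - c ∈ KZ.relations := by
  have hG1 : GG b 1 k = GGset b 1 k := hGG b 1 k
  rw [hG1]
  have hd : ∀ j, (if (L j).1 (Fin.last b) = 0 then 0 else e j) ≠ 0 →
      (L j).1 (Fin.last b) ≠ 0 ∧ e j ≠ 0 := by
    intro j hj
    by_cases h : (L j).1 (Fin.last b) = 0
    · simp [h] at hj
    · exact ⟨h, by simpa [h] using hj⟩
  refine sep_induction b k m' m M
    (MvPolynomial.C (∏ j, lead b (L j) (e j))⁻¹ * MvPolynomial.rename Fin.castSucc p₀)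
    (fun j => root b (L j)) a lo hi (GGset b 1 k) (fun n L' e' d s' ℓ hbd' hdom' hint' _ hℓ =>
      of_mem_GGset_of_shape M L' e' _ (MvPolynomial.C (∏ j, lead b (L j) (e j))⁻¹ * p₀)
        (by rw [map_mul, MvPolynomial.rename_C]) _ d a lo hi s' hbd' hdom' hint' ℓ hℓ) _ m
    (fun j => if (L j).1 (Fin.last b) = 0 then restr b (L j) else (0, 1))
    (fun j => if (L j).1 (Fin.last b) = 0 then e j else 0)
    (fun j => if (L j).1 (Fin.last b) = 0 then 0 else e j) s rfl hbd hdom (fun z hz => ?_)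
    (fun j hj z hz => ?_) (fun j j' hj hj' hne => ?_)
  · rw [hint hz]
    exact jshape_eq L e _ a z
  · obtain ⟨hα, he⟩ := hd j hj
    have h := hpole j hα he z hz
    rw [show (∑ i, ((L j).1 i : ℝ) * z (Fin.castAdd k i) + ((L j).2 : ℝ)) = affF b k (L j) z
      from rfl, affF_of_ne_zero (L j) z hα] at h
    exact right_ne_zero_of_mul h
  · obtain ⟨hα, he⟩ := hd j hj
    obtain ⟨hα', he'⟩ := hd j' hj'
    obtain ⟨C, hC⟩ := hrat j j' hα hα' he he' fun h => hne (root_eq_of_smul_eq hα hα' h)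
    exact ⟨C * |((L j).1 (Fin.last b) : ℝ)|, fun z hz => ratio_of_literal (L j) (L j') hα hα' z
      (hC z hz)⟩

open SeparatePos in
/-- **Wall-free separation** (registered sub-goal; corollary of `separatePos_of_dominated`).
As there, with the ratio condition replaced by: every resultant form
`α_j L_{j'} − α_{j'} L_j` (`= α_j α_{j'} (λ_j − λ_{j'})`) of two non-proportional active
`y`-letters is bounded away from `0` on the (bounded) domain, i.e. NO WALL `{λ_j = λ_{j'}}`
meets the closed base cell. -/
theorem separatePos_of_wallFree (GG : ℕ → ℕ → ℕ → Set KZ.FormalRep) (hGG : ∀ b σ k, GG b σ k = {w : KZ.FormalRep | ∃ (m m' n₁ n₂ : ℕ) (s : KZ.IntegralRep (b + 1 + k)) (M : Fin m' → (Fin (b + 1) → ℚ) × ℚ) (L : Fin m → (Fin b → ℚ) × ℚ) (e : Fin m → ℕ) (p : MvPolynomial (Fin b) ℚ) (ℓ₁ ℓ₂ : (Fin b → ℚ) × ℚ) (a : Fin k → Option ((Fin (b + 1) → ℚ) × ℚ)) (lo hi : Fin k → Fin k ⊕ ((Fin (b + 1) → ℚ) × ℚ)), (n₁ = 0 ∨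 n₂ = 0) ∧ (σ = 2 → (∀ i c, a i = some c → c.1 (Fin.last b) = 0) ∧ (∀ i c, (lo i = Sum.inr c ∨ hi i = Sum.inr c) → (c.1 (Fin.last b) = 0 ∨ c = (Pi.single (Fin.last b) 1, 0)))) ∧ Bornology.IsBounded s.domain ∧ s.domain = {z | (∀ j, 0 < ∑ i, ((M j).1 i : ℝ) * z (Fin.castAdd k i) + ((M j).2 : ℝ)) ∧ ∀ i, Sum.elim (fun j => z (Fin.natAdd (b + 1) j)) (fun c => ∑ i', (c.1 i' : ℝ) * z (Fin.castAdd k i') + (c.2 : ℝ)) (lo i) < z (Fin.natAdd (b + 1) i) ∧ z (Fin.natAdd (b + 1) i) < Sum.elim (fun j => z (Fin.natAdd (b + 1) j)) (fun c => ∑ i', (c.1 i' : ℝ) * z (Fin.castAdd k i') + (c.2 : ℝ)) (hi i)} ∧ EqOn s.integrand (fun z => MvPolynomial.aeval (fun i => z (Fin.castAdd k (Fin.castSucc i))) p / (∏ j, (∑ i, ((L j).1 i : ℝ) * z (Fin.castAdd k (Fin.castSucc i)) + ((L j).2 : ℝ)) ^ e j) * ((z (Fin.castAdd k (Fin.last b))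 - (∑ i, (ℓ₁.1 i : ℝ) * z (Fin.castAdd k (Fin.castSucc i)) + (ℓ₁.2 : ℝ))) ^ n₁ / (z (Fin.castAdd k (Fin.last b)) - (∑ i, (ℓ₂.1 i : ℝ) * z (Fin.castAdd k (Fin.castSucc i)) + (ℓ₂.2 : ℝ))) ^ n₂) * ∏ i, (a i).elim 1 (fun c => 1 / (z (Fin.natAdd (b + 1) i) - (∑ i', (c.1 i' : ℝ) * z (Fin.castAdd k i') + (c.2 : ℝ))))) s.domain ∧ w = KZ.of s}) (b k m m' : ℕ) (s : KZ.IntegralRep (b + 1 + k)) (M : Fin m' → (Fin (b + 1) → ℚ) × ℚ) (L : Fin m → (Fin (b + 1) → ℚ) × ℚ) (e : Fin m → ℕ) (p₀ : MvPolynomial (Fin b) ℚ) (a : Fin k → Option ((Fin (b + 1) → ℚ) × ℚ)) (lo hi : Fin k → Fin k ⊕ ((Fin (b + 1) → ℚ) × ℚ)) (hbd : Bornology.IsBounded s.domain) (hdom : s.domain = {z | (∀ j, 0 < ∑ i, ((M j).1 i : ℝ) * z (Fin.castAdd k i) + ((M j).2 : ℝ)) ∧ ∀ i, Sum.elim (fun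 j => z (Fin.natAdd (b + 1) j)) (fun c => ∑ i', (c.1 i' : ℝ) * z (Fin.castAdd k i') + (c.2 : ℝ)) (lo i) < z (Fin.natAdd (b + 1) i) ∧ z (Fin.natAdd (b + 1) i) < Sum.elim (fun j => z (Fin.natAdd (b + 1) j)) (fun c => ∑ i', (c.1 i' : ℝ) * z (Fin.castAdd k i') + (c.2 : ℝ)) (hi i)}) (hint : EqOn s.integrand (fun z => MvPolynomial.aeval (fun i => z (Fin.castAdd k i)) (MvPolynomial.rename Fin.castSucc p₀) / (∏ j, (∑ i, ((L j).1 i : ℝ) * z (Fin.castAdd k i) + ((L j).2 : ℝ)) ^ e j) * ∏ i, (a i).elim 1 (fun c => 1 / (z (Fin.natAdd (b + 1) i) - (∑ i', (c.1 i' : ℝ) * z (Fin.castAdd k i') + (c.2 : ℝ))))) s.domain) (hpole : ∀ j, (L j).1 (Fin.last b) ≠ 0 → e j ≠ 0 → ∀ z ∈ s.domain, ∑ i, ((L j).1 i : ℝ) * z (Fin.castAdd k i) + ((L j).2 : ℝ) ≠ 0) (hwall : ∀ j j', (L j).1 (Fin.last b) ≠ 0 → (L j').1 (Fin.last b) ≠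 0 → e j ≠ 0 → e j' ≠ 0 → (L j').1 (Fin.last b) • L j ≠ (L j).1 (Fin.last b) • L j' → ∃ c : ℝ, 0 < c ∧ ∀ z ∈ s.domain, c ≤ |((L j).1 (Fin.last b) : ℝ) * (∑ i, ((L j').1 i : ℝ) * z (Fin.castAdd k i) + ((L j').2 : ℝ)) - ((L j').1 (Fin.last b) : ℝ) * (∑ i, ((L j).1 i : ℝ) * z (Fin.castAdd k i) + ((L j).2 : ℝ))|) : ∃ c ∈ AddSubgroup.closure (GG b 1 k), KZ.of s - c ∈ KZ.relations := by
  refine separatePos_of_dominated GG hGG b k m m' s M L e p₀ a lo hi hbd hdom hint hpole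
    fun j j' hα hα' he he' hne => ?_
  obtain ⟨c, hc, hcb⟩ := hwall j j' hα hα' he he' hne
  obtain ⟨R, hR⟩ := hbd.exists_norm_le
  refine ⟨((∑ i, |((L j').1 i : ℝ)|) * R + |((L j').2 : ℝ)|) / c, fun z hz => ?_⟩
  have hnum : |affF b k (L j') z| ≤ (∑ i, |((L j').1 i : ℝ)|) * R + |((L j').2 : ℝ)| :=
    abs_affF_le _ (hR z hz)
  show |affF b k (L j') z| ≤ _
  rw [div_mul_eq_mul_div, le_div_iff₀ hc]
  exact mul_le_mul hnum (hcb z hz) hc.le ((abs_nonneg _).trans hnum)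

namespace SeparatePos

variable {b k m m' r : ℕ}

/-- Terminal case of the engine for a general numerator: if all active `y`-letters coincide, a
representation of separation shape lies literally in `GG♮ b k` (`n = ∑ dⱼ`). -/
theorem of_mem_GNset_of_shape (M : Fin m' → (Fin (b + 1) → ℚ) × ℚ) (L : Fin m → (Fin b → ℚ) × ℚ)
    (e : Fin m → ℕ) (p : MvPolynomial (Fin (b + 1)) ℚ) (lam : Fin r → (Fin b → ℚ) × ℚ)
    (d : Fin r → ℕ) (a : Fin k → Option ((Fin (b + 1) → ℚ) × ℚ))
    (lo hi : Fin k → Fin k ⊕ ((Fin (b + 1) → ℚ) × ℚ)) (s : KZ.IntegralRep (b + 1 + k))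
    (hbd : Bornology.IsBounded s.domain) (hdom : s.domain = gDom b k m' M lo hi)
    (hint : EqOn s.integrand (shape b k p L e lam d a) s.domain)
    (hpole : ∀ j, d j ≠ 0 → ∀ z ∈ s.domain,
      z (Fin.castAdd k (Fin.last b)) - affB b k (lam j) z ≠ 0)
    (ℓ : (Fin b → ℚ) × ℚ) (hℓ : ∀ j, d j ≠ 0 → lam j = ℓ) : KZ.of s ∈ GNset b k := by
  refine ⟨m, m', ∑ j, d j, s, M, L, e, p, ℓ, a, lo, hi, fun hn z hz => ?_, hbd, hdom,
    fun z hz => ?_, rfl⟩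
  · obtain ⟨j, -, hj⟩ := Finset.exists_ne_zero_of_sum_ne_zero hn
    have h := hpole j hj z hz
    rwa [hℓ j hj] at h
  · rw [hint hz]
    simp only [shape, fib, affB, one_div]
    congr 2
    rw [← Finset.prod_pow_eq_pow_sum, ← Finset.prod_inv_distrib]
    refine Finset.prod_congr rfl fun j _ => ?_
    by_cases hj : d j = 0
    · simp [hj]
    · rw [hℓ j hj]

end SeparatePos

open SeparatePos in
/-- **Separation with the numerator carried** (registered sub-goal of `stub_separatePos`).
Let `s` be a Janus band representation over the base `ℝ^{b+1}` with `k` fibres (literal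
`JJ (b+1) k` data, ANY numerator `p : MvPolynomial (Fin (b+1)) ℚ`) whose active `y`-letters
(`(L j).1 (Fin.last b) ≠ 0`, `e j ≠ 0`) do not vanish on the domain and which satisfies the
RATIO condition `|L_{j'}(z)| ≤ C · |α_j L_{j'}(z) − α_{j'} L_j(z)|` on the domain for every
ordered pair of non-proportional active letters. Then `[s]` is congruent modulo `KZ.relations`
to a `ℤ`-combination of representations of the intermediate class `GG♮ b k`: polyhedral base
cell × Janus fibres, integrand `p(x', y)/∏ Lⱼ(x')^{eⱼ} · (y − ℓ(x'))^{−n} · (fibre block)` with a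
single `y`-pole, non-vanishing on the domain when `n ≠ 0`. -/
theorem separatePos_carry (b k m m' : ℕ) (s : KZ.IntegralRep (b + 1 + k)) (M : Fin m' → (Fin (b + 1) → ℚ) × ℚ) (L : Fin m → (Fin (b + 1) → ℚ) × ℚ) (e : Fin m → ℕ) (p : MvPolynomial (Fin (b + 1)) ℚ) (a : Fin k → Option ((Fin (b + 1) → ℚ) × ℚ)) (lo hi : Fin k → Fin k ⊕ ((Fin (b + 1) → ℚ) × ℚ)) (hbd : Bornology.IsBounded s.domain) (hdom : s.domain = {z | (∀ j, 0 < ∑ i, ((M j).1 i : ℝ) * z (Fin.castAdd k i) + ((M j).2 : ℝ)) ∧ ∀ i, Sum.elim (fun j => z (Fin.natAdd (b + 1) j)) (fun c => ∑ i', (c.1 i' : ℝ) * z (Fin.castAdd k i') + (c.2 : ℝ)) (lo i) < z (Fin.natAdd (b + 1) i) ∧ z (Fin.natAdd (b + 1) i) < Sum.elim (fun j => z (Fin.natAdd (b + 1) j)) (fun c => ∑ i', (c.1 i' : ℝ) * z (Fin.castAdd k i') + (c.2 : ℝ)) (hi i)}) (hint : EqOn s.integrand (fun z => MvPolynomial.aeval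 (fun i => z (Fin.castAdd k i)) p / (∏ j, (∑ i, ((L j).1 i : ℝ) * z (Fin.castAdd k i) + ((L j).2 : ℝ)) ^ e j) * ∏ i, (a i).elim 1 (fun c => 1 / (z (Fin.natAdd (b + 1) i) - (∑ i', (c.1 i' : ℝ) * z (Fin.castAdd k i') + (c.2 : ℝ))))) s.domain) (hpole : ∀ j, (L j).1 (Fin.last b) ≠ 0 → e j ≠ 0 → ∀ z ∈ s.domain, ∑ i, ((L j).1 i : ℝ) * z (Fin.castAdd k i) + ((L j).2 : ℝ) ≠ 0) (hrat : ∀ j j', (L j).1 (Fin.last b) ≠ 0 → (L j').1 (Fin.last b) ≠ 0 → e j ≠ 0 → e j' ≠ 0 → (L j').1 (Fin.last b) • L j ≠ (L j).1 (Fin.last b) • L j' → ∃ C : ℝ, ∀ z ∈ s.domain, |∑ i, ((L j').1 i : ℝ) * z (Fin.castAdd k i) + ((L j').2 : ℝ)| ≤ C * |((L j).1 (Fin.last b) : ℝ) * (∑ i, ((L j').1 i : ℝ) * z (Fin.castAdd k i) + ((L j').2 : ℝ)) - ((L j').1 (Fin.last b) : ℝ) * (∑ i, ((L j).1 i : ℝ)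 * z (Fin.castAdd k i) + ((L j).2 : ℝ))|) : ∃ c ∈ AddSubgroup.closure {w : KZ.FormalRep | ∃ (m m' n : ℕ) (s : KZ.IntegralRep (b + 1 + k)) (M : Fin m' → (Fin (b + 1) → ℚ) × ℚ) (L : Fin m → (Fin b → ℚ) × ℚ) (e : Fin m → ℕ) (p : MvPolynomial (Fin (b + 1)) ℚ) (ℓ : (Fin b → ℚ) × ℚ) (a : Fin k → Option ((Fin (b + 1) → ℚ) × ℚ)) (lo hi : Fin k → Fin k ⊕ ((Fin (b + 1) → ℚ) × ℚ)), (n ≠ 0 → ∀ z ∈ s.domain, z (Fin.castAdd k (Fin.last b)) - (∑ i, (ℓ.1 i : ℝ) * z (Fin.castAdd k (Fin.castSucc i)) + (ℓ.2 : ℝ)) ≠ 0) ∧ Bornology.IsBounded s.domain ∧ s.domain = {z | (∀ j, 0 < ∑ i, ((M j).1 i : ℝ) * z (Fin.castAdd k i) + ((M j).2 : ℝ)) ∧ ∀ i, Sum.elim (fun j => z (Fin.natAdd (b + 1) j)) (fun c => ∑ i', (c.1 i' : ℝ) * z (Fin.castAdd k i') + (c.2 : ℝ)) (lo i) < z (Fin.natAdd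 (b + 1) i) ∧ z (Fin.natAdd (b + 1) i) < Sum.elim (fun j => z (Fin.natAdd (b + 1) j)) (fun c => ∑ i', (c.1 i' : ℝ) * z (Fin.castAdd k i') + (c.2 : ℝ)) (hi i)} ∧ EqOn s.integrand (fun z => MvPolynomial.aeval (fun i => z (Fin.castAdd k i)) p / (∏ j, (∑ i, ((L j).1 i : ℝ) * z (Fin.castAdd k (Fin.castSucc i)) + ((L j).2 : ℝ)) ^ e j) * (1 / (z (Fin.castAdd k (Fin.last b)) - (∑ i, (ℓ.1 i : ℝ) * z (Fin.castAdd k (Fin.castSucc i)) + (ℓ.2 : ℝ))) ^ n) * ∏ i, (a i).elim 1 (fun c => 1 / (z (Fin.natAdd (b + 1) i) - (∑ i', (c.1 i' : ℝ) * z (Fin.castAdd k i') + (c.2 : ℝ))))) s.domain ∧ w = KZ.of s}, KZ.of s - c ∈ KZ.relations := by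
  show ∃ c ∈ AddSubgroup.closure (GNset b k), KZ.of s - c ∈ KZ.relations
  have hd : ∀ j, (if (L j).1 (Fin.last b) = 0 then 0 else e j) ≠ 0 →
      (L j).1 (Fin.last b) ≠ 0 ∧ e j ≠ 0 := by
    intro j hj
    by_cases h : (L j).1 (Fin.last b) = 0
    · simp [h] at hj
    · exact ⟨h, by simpa [h] using hj⟩
  refine sep_induction b k m' m M (MvPolynomial.C (∏ j, lead b (L j) (e j))⁻¹ * p)
    (fun j => root b (L j)) a lo hi (GNset b k) (fun n L' e' d s' ℓ hbd' hdom' hint' hpole' hℓ =>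
      of_mem_GNset_of_shape M L' e' _ _ d a lo hi s' hbd' hdom' hint' hpole' ℓ hℓ) _ m
    (fun j => if (L j).1 (Fin.last b) = 0 then restr b (L j) else (0, 1))
    (fun j => if (L j).1 (Fin.last b) = 0 then e j else 0)
    (fun j => if (L j).1 (Fin.last b) = 0 then 0 else e j) s rfl hbd hdom (fun z hz => ?_)
    (fun j hj z hz => ?_) (fun j j' hj hj' hne => ?_)
  · rw [hint hz]
    exact jshape_eq L e _ a z
  · obtain ⟨hα, he⟩ := hd j hj
    have h := hpole j hα he z hz
    rw [show (∑ i, ((L j).1 i : ℝ) * z (Fin.castAdd k i) + ((L j).2 : ℝ)) = affF b k (L j) z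
      from rfl, affF_of_ne_zero (L j) z hα] at h
    exact right_ne_zero_of_mul h
  · obtain ⟨hα, he⟩ := hd j hj
    obtain ⟨hα', he'⟩ := hd j' hj'
    obtain ⟨C, hC⟩ := hrat j j' hα hα' he he' fun h => hne (root_eq_of_smul_eq hα hα' h)
    exact ⟨C * |((L j).1 (Fin.last b) : ℝ)|, fun z hz => ratio_of_literal (L j) (L j') hα hα' z
      (hC z hz)⟩

end Summit.KontsevichZagierPeriods.ArrangementNormalForm.JanusBands
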